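import Literature.MathematicalPhysics.KineticTheory.LangevinChainReach
import HarnessLib

/-!
# The pinned chain reaches the equilibrium ball with probability bounded below, uniformly on compact sets and in the bath temperatures

Helper file (`--supports`) for item stmt-AtomisticToContinuum-14071 (`CorrectorTheory`, route
`OddSectorIrreversibility`, sub-problem `FouriersLaw` of `AtomisticToContinuum`): the third input of the
uniform-in-`δ` Harris bound to which conjunct B of the item is reduced in the tree. The pointed
irreducibility `pinnedChain_transitionKernel_pos_of_mem_nhds_zero` (`LangevinChainReach.lean`) gives
`P_t(z, G) > 0` for each `z` and all large `t`; here the lower bound is made UNIFORM over an energy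
sublevel set `{H ≤ E}` (compact) and over all bath temperatures with bounded noise amplitudes:

* `pinnedChain_hamiltonian_freeFlow_lt_uniform` — LaSalle, uniformly on `{H ≤ E}`: the undriven
  damped flow brings the whole sublevel set into `{H < η₀}` after one time `s₁` and keeps it there
  (pointwise convergence to `0`, continuity in the initial condition, monotonicity of `H`,
  compactness);
* `pinnedChain_reach_uniform` — for every `E`, `r > 0`, `cmax` there is `s₁` such that for every
  `t ≥ s₁` some `p > 0` bounds `P^{T_L,T_R}_t(z, B(0,r)) ≥ p` for all `H(z) ≤ E` and all bath
  temperatures with `√(2γT_L) + √(2γT_R) ≤ cmax` (noise continuity on `{H ≤ E}` and the small-ball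
  probability of the Brownian pair, which only improves for smaller amplitudes).

No definitions, no named facts.
-/

noncomputable section

open MeasureTheory ProbabilityTheory Filter Topology Set Metric
open scoped NNReal ENNReal

namespace Summit.AtomisticToContinuum.FouriersLaw.Theorems.OddSectorIrreversibility.Corrector

open Literature.MathematicalPhysics.KineticTheory.HeatConduction
open Literature.Probability.Process OscillatorChain
open Literature.MathematicalPhysics.KineticTheory

variable {N : ℕ}

/-- The equilibrium has zero energy. [folklore] -/
theorem pinnedChain_hamiltonian_origin (ω₂ lam β γ : ℝ) (N : ℕ) :
    (pinnedChain ω₂ lam β γ).hamiltonian N 0 = 0 := by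
  simp [OscillatorChain.hamiltonian, pinnedChain]

section Reach

variable {ω₂ lam β γ : ℝ} (hω : 0 < ω₂) (hl : 0 ≤ lam) (hβ : 0 ≤ β) (hγ : 0 < γ) (hN : 0 < N)
include hω hl hβ hγ hN

/-- **LaSalle, uniformly on an energy sublevel set.** For every `E` and `η₀ > 0` there is `s₁ ≥ 0`
such that the undriven damped flow satisfies `H(φ_t(z)) < η₀` for all `H(z) ≤ E` and all `t ≥ s₁`:
each trajectory tends to `0` (`pinnedChain_tendsto_freeFlow_zero`), so enters the open set
`{H < η₀}` at some time; by continuity in the initial condition a whole neighbourhood enters at that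
time; `H` is non-increasing along the flow, so it stays; and `{H ≤ E}` is compact.
[cite: CuneoEckmannHairerReyBellet2018, Prop 3.3] -/
theorem pinnedChain_hamiltonian_freeFlow_lt_uniform (E : ℝ) {η₀ : ℝ} (hη₀ : 0 < η₀) :
    ∃ s₁ : ℝ, 0 ≤ s₁ ∧ ∀ z : PhaseSpace N, (pinnedChain ω₂ lam β γ).hamiltonian N z ≤ E →
      ∀ t : ℝ, s₁ ≤ t →
        (pinnedChain ω₂ lam β γ).hamiltonian N ((pinnedChain ω₂ lam β γ).chainFlow N z 0 t) < η₀ := by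
  set P := pinnedChain ω₂ lam β γ with hP
  set Hm := P.hamiltonian N with hHm
  have hHc : Continuous Hm := pinnedChain_continuous_hamiltonian ω₂ lam β γ N
  -- each point enters `{H < η₀}` at some nonnegative time
  have henter : ∀ z : PhaseSpace N, ∃ tz : ℝ, 0 ≤ tz ∧ Hm (P.chainFlow N z 0 tz) < η₀ := by
    intro z
    have hlim := pinnedChain_tendsto_freeFlow_zero hω hl hβ hγ hN z
    have hH : Tendsto (fun t => Hm (P.chainFlow N z 0 t)) atTop (𝓝 (Hm 0)) := (hHc.tendsto 0).comp hlim
    rw [show Hm 0 = 0 from pinnedChain_hamiltonian_origin ω₂ lam β γ N] at hH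
    have hev : ∀ᶠ t : ℝ in atTop, Hm (P.chainFlow N z 0 t) < η₀ := hH (Iio_mem_nhds hη₀)
    obtain ⟨t₁, ht₁⟩ := eventually_atTop.1 hev
    exact ⟨max t₁ 0, le_max_right _ _, ht₁ _ (le_max_left _ _)⟩
  choose tz htz0 htz using henter
  -- the open neighbourhoods entering at that time
  set U : PhaseSpace N → Set (PhaseSpace N) := fun z => {z' | Hm (P.chainFlow N z' 0 (tz z)) < η₀} with hU
  have hUo : ∀ z, IsOpen (U z) := fun z =>
    isOpen_lt (hHc.comp (pinnedChain_continuous_chainFlow_left hω hl hβ hγ.le N continuous_zero (tz z)))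
      continuous_const
  have hzU : ∀ z, z ∈ U z := fun z => htz z
  have hC : IsCompact {z : PhaseSpace N | Hm z ≤ E} := pinnedChain_isCompact_setOf_hamiltonian_le hω hl hβ γ N E
  obtain ⟨F, -, hcover⟩ := hC.elim_nhds_subcover U fun z _ => (hUo z).mem_nhds (hzU z)
  refine ⟨∑ z ∈ F, tz z, Finset.sum_nonneg fun z _ => htz0 z, fun z hz t ht => ?_⟩
  have hmem := hcover hz
  simp only [mem_iUnion] at hmem
  obtain ⟨z₀, hz₀F, hzz₀⟩ := hmem
  have htz_le : tz z₀ ≤ t := by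
    have h1 : tz z₀ ≤ ∑ z ∈ F, tz z := Finset.single_le_sum (fun z _ => htz0 z) hz₀F
    exact h1.trans ht
  have hsplit : P.chainFlow N z 0 t = P.chainFlow N (P.chainFlow N z 0 (tz z₀)) 0 (t - tz z₀) := by
    have := pinnedChain_freeFlow_add hω hl hβ hγ.le N z (htz0 z₀) (sub_nonneg.2 htz_le)
    rw [add_sub_cancel] at this
    exact this
  rw [hsplit]
  exact (pinnedChain_hamiltonian_freeFlow_le hω hl hβ hγ.le N _ _).trans_lt hzz₀

/-- **Uniform reachability of the equilibrium ball.** For every energy level `E`, radius `r > 0`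
and amplitude bound `cmax` there is `s₁` such that for every `t ≥ s₁` some `p > 0` satisfies
`P^{T_L,T_R}_t(z, B(0, r)) ≥ p` for all `H(z) ≤ E` and all bath temperatures with
`|√(2γT_L)| + |√(2γT_R)| ≤ cmax`: the undriven flow is in `B(0, r/2)` from time `s₁` on
(`pinnedChain_hamiltonian_freeFlow_lt_uniform` and the coercivity of `H`), the driven flow is
`r/2`-close to it when the noise path is small on `[0, t]`, uniformly on `{H ≤ E}`
(`pinnedChain_exists_norm_chainFlow_sub_lt`), and the Brownian pair is that small with positive
probability (`wienerPair_forall_abs_brownian_le_pos`). [cite: CuneoEckmannHairerReyBellet2018, Prop 3.3] -/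
theorem pinnedChain_reach_uniform (E : ℝ) {r : ℝ} (hr : 0 < r) {cmax : ℝ} (hcmax : 0 ≤ cmax) :
    ∃ s₁ : ℝ≥0, ∀ t : ℝ≥0, s₁ ≤ t → ∃ p : ℝ≥0∞, 0 < p ∧
      ∀ T_L T_R : ℝ, |Real.sqrt (2 * γ * T_L)| + |Real.sqrt (2 * γ * T_R)| ≤ cmax →
        ∀ z : PhaseSpace N, (pinnedChain ω₂ lam β γ).hamiltonian N z ≤ E →
          p ≤ (pinnedChain ω₂ lam β γ).transitionKernel N T_L T_R t z (ball 0 r) := by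
  set P := pinnedChain ω₂ lam β γ with hP
  set Hm := P.hamiltonian N with hHm
  -- the energy level `η₀` below which points are in `B(0, r/2)`
  set η₀ : ℝ := min ω₂ 1 * r ^ 2 / 16 with hη₀
  have hη₀pos : 0 < η₀ := by rw [hη₀]; positivity
  have hsmallball : ∀ x : PhaseSpace N, Hm x < η₀ → ‖x‖ < r / 2 := by
    intro x hx
    have hmem := pinnedChain_setOf_hamiltonian_le_subset_closedBall hω hl hβ γ N η₀ (le_of_lt hx)
    rw [mem_closedBall, dist_zero_right] at hmem
    have hmin1 : min ω₂ 1 ≤ 1 := min_le_right _ _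
    have hminω : min ω₂ 1 ≤ ω₂ := min_le_left _ _
    have hmin0 : 0 < min ω₂ 1 := lt_min hω one_pos
    have h1 : 2 * η₀ / ω₂ ≤ r ^ 2 / 8 := by
      rw [div_le_iff₀ hω, hη₀]
      nlinarith [sq_nonneg r]
    have h2 : 2 * η₀ ≤ r ^ 2 / 8 := by rw [hη₀]; nlinarith [sq_nonneg r]
    have h3 : Real.sqrt (r ^ 2 / 8) < r / 2 := by
      rw [Real.sqrt_lt' (by positivity)]
      nlinarith
    have h4 : max (Real.sqrt (2 * η₀ / ω₂)) (Real.sqrt (2 * η₀)) ≤ Real.sqrt (r ^ 2 / 8) :=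
      max_le (Real.sqrt_le_sqrt h1) (Real.sqrt_le_sqrt h2)
    exact hmem.trans_lt (h4.trans_lt h3)
  -- LaSalle, uniformly on `{H ≤ E}`
  obtain ⟨s₁, hs₁0, hs₁⟩ := pinnedChain_hamiltonian_freeFlow_lt_uniform hω hl hβ hγ hN E hη₀pos
  refine ⟨⟨s₁, hs₁0⟩, fun t ht => ?_⟩
  have hts₁ : s₁ ≤ (t : ℝ) := by exact_mod_cast ht
  have hfree : ∀ z : PhaseSpace N, Hm z ≤ E → ‖P.chainFlow N z 0 t‖ < r / 2 := fun z hz =>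
    hsmallball _ (hs₁ z hz t hts₁)
  -- continuity in the noise on `[0, t]`, noise bounded by `1`, uniformly on `{H ≤ E}`
  obtain ⟨δ, hδ, hcont⟩ := pinnedChain_exists_norm_chainFlow_sub_lt hω hl hβ hγ.le N E 1 (t : ℝ) (half_pos hr)
  -- the small ball of the Brownian pair (sized for the largest amplitudes)
  set ε' : ℝ := min δ 1 / (cmax + 1) with hε'
  have hC : 0 < cmax + 1 := by linarith
  have hε'0 : 0 < ε' := div_pos (lt_min hδ one_pos) hC
  have hε'b : cmax * ε' ≤ min δ 1 := by
    rw [hε', mul_div_assoc']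
    rw [div_le_iff₀ hC]
    have : 0 ≤ min δ 1 := (lt_min hδ one_pos).le
    nlinarith
  set A : Set WienerPair := {ω | ∀ u : ℝ≥0, u ≤ t → |brownian u ω.1| ≤ ε' ∧ |brownian u ω.2| ≤ ε'}
    with hA
  have hApos : 0 < wienerPair A := wienerPair_forall_abs_brownian_le_pos t hε'0
  refine ⟨wienerPair A, hApos, fun T_L T_R hamp z hz => ?_⟩
  set cL : ℝ := Real.sqrt (2 * γ * T_L) with hcL
  set cR : ℝ := Real.sqrt (2 * γ * T_R) with hcR
  -- on `A`, the solution lands in `B(0, r)`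
  have hsub : A ⊆ (fun ω => P.solMap N T_L T_R t z (pairPath ω)) ⁻¹' ball 0 r := by
    intro ω hωA
    rw [mem_preimage, mem_ball, dist_zero_right]
    set η : ℝ → Fin N → ℝ := chainNoise N cL cR (pairPath ω) with hη
    have hηc : Continuous η := continuous_chainNoise cL cR (pairPath ω)
    have hηsmall : ∀ s ∈ Icc (0 : ℝ) t, ‖η s‖ ≤ min δ 1 := by
      intro s hs
      have hst : s.toNNReal ≤ t := Real.toNNReal_le_iff_le_coe.2 hs.2
      obtain ⟨h1, h2⟩ := hωA _ hst
      refine (norm_chainNoise_pairPath_le cL cR ω s).trans (le_trans ?_ hε'b)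
      have hcL0 : 0 ≤ |cL| := abs_nonneg _
      have hcR0 : 0 ≤ |cR| := abs_nonneg _
      have h3 : |cL| * |brownian s.toNNReal ω.1| + |cR| * |brownian s.toNNReal ω.2| ≤ (|cL| + |cR|) * ε' := by
        nlinarith [mul_le_mul_of_nonneg_left h1 hcL0, mul_le_mul_of_nonneg_left h2 hcR0]
      exact h3.trans (mul_le_mul_of_nonneg_right hamp hε'0.le)
    have h1 : ‖P.chainFlow N z η t - P.chainFlow N z 0 t‖ < r / 2 :=
      hcont z hz η 0 hηc continuous_zero
        (fun s hs => (hηsmall s hs).trans (min_le_right _ _))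
        (fun s _ => by simp)
        (fun s hs => by simpa using (hηsmall s hs).trans (min_le_left _ _))
        t ⟨t.coe_nonneg, le_rfl⟩
    have hsol : P.solMap N T_L T_R t z (pairPath ω) = P.chainFlow N z η t := rfl
    rw [hsol]
    calc ‖P.chainFlow N z η t‖ = ‖(P.chainFlow N z η t - P.chainFlow N z 0 t) + P.chainFlow N z 0 t‖ := by
          rw [sub_add_cancel]
      _ ≤ ‖P.chainFlow N z η t - P.chainFlow N z 0 t‖ + ‖P.chainFlow N z 0 t‖ := norm_add_le _ _
      _ < r / 2 + r / 2 := add_lt_add h1 (hfree z hz)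
      _ = r := by ring
  -- conclude
  calc wienerPair A
      ≤ wienerPair ((fun ω => P.solMap N T_L T_R t z (pairPath ω)) ⁻¹' ball 0 r) := measure_mono hsub
    _ = P.transitionKernel N T_L T_R t z (ball 0 r) :=
        (pinnedChain_transitionKernel_apply' hω hl hβ hγ.le N T_L T_R t z measurableSet_ball).symm

end Reach

end Summit.AtomisticToContinuum.FouriersLaw.Theorems.OddSectorIrreversibility.Corrector

end
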